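import Summits.QuantumFields.YangMills.Theorems.LuscherReductionTwistedTraceScalingBOStiffTailFP
import Summits.QuantumFields.YangMills.Theorems.LuscherReductionTwistedTraceScalingBOStiffSplit
import HarnessLib

/-!
# (B-ST) top-level assembly in abstract form: `hST` from a core bound and two tail bounds
# (lane A of S-BASE, crux `TwistedTraceScaling` stmt-QuantumFields-20203, C4-CORE, the (B-ST) pen; HANDOFF-g21 ASSEMBLY RECIPE steps 1–3)

The hypothesis `hST` of `…BORecordInputOfST.recordAnalyticInput_of_hST` reads, for fixed `β`, `θ₀`:
`∀ v` bounded measurable, supported in `{χ ≠ 0}`, fibre-orthogonal to `Ω_c`, `tubeForm β v ≤ (1 − θ₀)·Λ·tubeNormSq (softWeight χ) v`.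
This file reduces it, ONCE AND FOR ALL, to three estimates on the based average `P₀f (U) = ∫ f(U^{basedExt h}) dh` of the three pieces of `v` cut out by two
measurable sets `S₂` (gauge-far), `S₃` (stiff shell) — `v₁ = 𝟙_{(S₂∪S₃)ᶜ} v` (core), `v₂ = 𝟙_{S₂} v`, `v₃ = 𝟙_{S₃∖S₂} v`:
★★★ `tubeForm_le_of_pieces` — if `⟨P₀vᵢ, K_β P₀vᵢ⟩ ≤ aᵢ·‖v‖²_w` (`i = 1,2,3`) then `tubeForm β v ≤ (√a₁ + √a₂ + √a₃)²·‖v‖²_w`;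
★★★ `hST_of_pieces` — the literal `hST`-shaped conclusion `∀ v …, tubeForm β v ≤ (1 − θ₀)·Λ·tubeNormSq (softWeight χ) v` from the three piece bounds (each may use all
four admissibility hypotheses on `v`, the orthogonality entering as an arbitrary predicate `Adm`) and `(√a₁ + √a₂ + √a₃)² ≤ (1 − θ₀)Λ`.
Ingredients: step (A) `tubeForm_le_qform_basedIntegral` (✓ `…BOStiffColour`), the seminorm triangle `kform_add_three_le_of_le` (✓ `…BOStiffSplit`) for the PSD transfer kernel
(`qform_self_nonneg_bdd`).  The suppliers of the three bounds are the instance files (core: `…BOStiffSlowAssembly` chain; tails: `…BOStiffTailFP`, `…BOStiffTailShell`).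
HONEST FRAMING: bookkeeping for a stub of a child of the CONDITIONAL route R2b1; (B-ST) OPEN; C4-CORE OPEN; not infinite volume, not a gap, not Clay.
-/

set_option autoImplicit false

noncomputable section

open MeasureTheory

namespace Summit.QuantumFields.YangMills.Theorems.FemtoTransferGap.TwoLattice.ConstTube

open Literature.MathematicalPhysics.QuantumFieldTheory Literature.MathematicalPhysics.QuantumLattice TwoLattice.Avg StiffDoor

variable {L : ℕ} [NeZero L]

/-! ## §1 The transfer form as an iterated kernel form -/

/-- `⟨f, K_β f⟩ = ∫∫ f(U) K_β(U,V) f(V) dU dV` (iterated) for bounded measurable `f`. [folklore] -/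
theorem qform_eq_integral_integral_bdd (β : ℝ) {f : GaugeConfig 3 L SU2 → ℝ} (hf : Measurable f) {Cf : ℝ} (hCf : ∀ U, |f U| ≤ Cf) :
    qform su2Rep β f f = ∫ U, ∫ V, f U * transferKernel su2Rep β U V * f V ∂configMeasure SU2 L ∂configMeasure SU2 L := by
  obtain ⟨M, hM⟩ := exists_transferKernel_le su2Rep continuous_su2Rep β (L := L)
  have hCf0 : 0 ≤ Cf := (abs_nonneg _).trans (hCf 1)
  have hK : Measurable fun p : GaugeConfig 3 L SU2 × GaugeConfig 3 L SU2 => transferKernel su2Rep β p.1 p.2 :=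
    (continuous_transferKernel su2Rep continuous_su2Rep β).measurable
  have hm : Measurable (Function.uncurry fun U V : GaugeConfig 3 L SU2 => f U * transferKernel su2Rep β U V * f V) :=
    ((hf.comp measurable_fst).mul hK).mul (hf.comp measurable_snd)
  have hb : ∀ U V : GaugeConfig 3 L SU2, |f U * transferKernel su2Rep β U V * f V| ≤ Cf * M * Cf := fun U V => by
    rw [abs_mul, abs_mul, abs_of_pos (transferKernel_pos su2Rep β _ _)]
    exact mul_le_mul (mul_le_mul (hCf _) (hM _ _) (transferKernel_pos su2Rep β _ _).le hCf0) (hCf _) (abs_nonneg _)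
      (mul_nonneg hCf0 ((transferKernel_pos su2Rep β U V).le.trans (hM _ _)))
  rw [qform_eq_integral_prod_bdd β hf hCf hf hCf, ← integral_integral_eq_prod hm hb]

/-- The transfer kernel is bounded measurable symmetric and positive semi-definite on bounded measurable functions (`β ≥ 0`) — the data of the abstract kernel-form lemmas
of `…BOStiffFibreBilinear` / `…BOStiffSplit` for `M = K_β`, `μ = configMeasure`. [cite: SeilerLNP1982, §3] -/
theorem transferKernel_kform_data {β : ℝ} (hβ : 0 ≤ β) :
    Measurable (Function.uncurry fun U V : GaugeConfig 3 L SU2 => transferKernel su2Rep β U V) ∧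
    (∃ CM : ℝ, ∀ U V : GaugeConfig 3 L SU2, |transferKernel su2Rep β U V| ≤ CM) ∧
    (∀ U V : GaugeConfig 3 L SU2, transferKernel su2Rep β U V = transferKernel su2Rep β V U) ∧
    (∀ f : GaugeConfig 3 L SU2 → ℝ, Measurable f → (∃ C : ℝ, ∀ U, |f U| ≤ C) →
      0 ≤ ∫ U, ∫ V, f U * transferKernel su2Rep β U V * f V ∂configMeasure SU2 L ∂configMeasure SU2 L) := by
  obtain ⟨M, hM⟩ := exists_transferKernel_le su2Rep continuous_su2Rep β (L := L)
  refine ⟨(continuous_transferKernel su2Rep continuous_su2Rep β).measurable, ⟨M, fun U V => ?_⟩, fun U V => transferKernel_su2Rep_symm β U V, fun f hf ⟨C, hC⟩ => ?_⟩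
  · rw [abs_of_pos (transferKernel_pos su2Rep β _ _)]; exact hM U V
  · rw [← qform_eq_integral_integral_bdd β hf hC]; exact qform_self_nonneg_bdd hβ hf hC

/-! ## §2 Splitting the based average -/

/-- The based average is additive on bounded measurable functions. [folklore] -/
theorem basedIntegral_add {f g : GaugeConfig 3 L SU2 → ℝ} (hf : Measurable f) {Cf : ℝ} (hCf : ∀ U, |f U| ≤ Cf) (hg : Measurable g) {Cg : ℝ} (hCg : ∀ U, |g U| ≤ Cg)
    (U : GaugeConfig 3 L SU2) :
    (∫ h, (f (gaugeTransform (basedExt L h) U) + g (gaugeTransform (basedExt L h) U)) ∂basedMeasure L) =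
      (∫ h, f (gaugeTransform (basedExt L h) U) ∂basedMeasure L) + ∫ h, g (gaugeTransform (basedExt L h) U) ∂basedMeasure L := by
  haveI : IsProbabilityMeasure (basedMeasure L) := by unfold basedMeasure; infer_instance
  have hi : ∀ {φ : GaugeConfig 3 L SU2 → ℝ}, Measurable φ → ∀ {C : ℝ}, (∀ U, |φ U| ≤ C) → Integrable (fun h : NzSite L → SU2 => φ (gaugeTransform (basedExt L h) U)) (basedMeasure L) :=
    fun hφ C hC => integrable_of_measurable_abs_le _ (measurable_comp_basedExt_left hφ U) (C := C) fun h => hC _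
  exact integral_add (hi hf hCf) (hi hg hCg)

omit [NeZero L] in
/-- An indicator piece of a bounded measurable function is bounded measurable with the same bound. [folklore] -/
theorem indicator_piece_props {v : GaugeConfig 3 L SU2 → ℝ} (hv : Measurable v) {Cv : ℝ} (hCv : ∀ U, |v U| ≤ Cv) {S : Set (GaugeConfig 3 L SU2)} (hS : MeasurableSet S) :
    Measurable (S.indicator v) ∧ ∀ U, |S.indicator v U| ≤ Cv :=
  ⟨hv.indicator hS, fun U => by
    have h := norm_indicator_le_norm_self (s := S) v U
    rw [Real.norm_eq_abs, Real.norm_eq_abs] at h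
    exact h.trans (hCv U)⟩

omit [NeZero L] in
/-- The three-piece decomposition `v = 𝟙_{(S₂∪S₃)ᶜ} v + 𝟙_{S₂} v + 𝟙_{S₃∖S₂} v`. [folklore] -/
theorem three_piece_decomp (v : GaugeConfig 3 L SU2 → ℝ) (S₂ S₃ : Set (GaugeConfig 3 L SU2)) (U : GaugeConfig 3 L SU2) :
    v U = (S₂ ∪ S₃)ᶜ.indicator v U + S₂.indicator v U + (S₃ \ S₂).indicator v U := by
  by_cases h2 : U ∈ S₂
  · have h1 : U ∉ (S₂ ∪ S₃)ᶜ := fun h => h (Or.inl h2)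
    have h3 : U ∉ S₃ \ S₂ := fun h => h.2 h2
    rw [Set.indicator_of_notMem h1, Set.indicator_of_mem h2, Set.indicator_of_notMem h3]; ring
  · by_cases h3 : U ∈ S₃
    · have h1 : U ∉ (S₂ ∪ S₃)ᶜ := fun h => h (Or.inr h3)
      have h3' : U ∈ S₃ \ S₂ := ⟨h3, h2⟩
      rw [Set.indicator_of_notMem h1, Set.indicator_of_notMem h2, Set.indicator_of_mem h3']; ring
    · have h1 : U ∈ (S₂ ∪ S₃)ᶜ := fun h => h.elim h2 h3
      have h3' : U ∉ S₃ \ S₂ := fun h => h3 h.1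
      rw [Set.indicator_of_mem h1, Set.indicator_of_notMem h2, Set.indicator_of_notMem h3']; ring

/-! ## §3 The assembly -/

/-- ★★★ **Tube form from three piece bounds.**  For `β ≥ 0`, bounded measurable `v`, measurable `S₂, S₃` and the pieces `v₁ = 𝟙_{(S₂∪S₃)ᶜ} v`, `v₂ = 𝟙_{S₂} v`,
`v₃ = 𝟙_{S₃∖S₂} v`: if `⟨P₀vᵢ, K_β P₀vᵢ⟩ ≤ aᵢ N` with `aᵢ, N ≥ 0`, then `tubeForm β v ≤ (√a₁ + √a₂ + √a₃)² N`
(step (A) `tubeForm_le_qform_basedIntegral` + additivity of `P₀` + the PSD seminorm triangle). [cite: SeilerLNP1982, §3] -/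
theorem tubeForm_le_of_pieces {β : ℝ} (hβ : 0 ≤ β) {v : GaugeConfig 3 L SU2 → ℝ} (hv : Measurable v) {Cv : ℝ} (hCv : ∀ U, |v U| ≤ Cv)
    {S₂ S₃ : Set (GaugeConfig 3 L SU2)} (hS₂ : MeasurableSet S₂) (hS₃ : MeasurableSet S₃) {a₁ a₂ a₃ N : ℝ} (ha₁ : 0 ≤ a₁) (ha₂ : 0 ≤ a₂) (ha₃ : 0 ≤ a₃) (hN : 0 ≤ N)
    (h₁ : qform su2Rep β (fun U => ∫ h, (S₂ ∪ S₃)ᶜ.indicator v (gaugeTransform (basedExt L h) U) ∂basedMeasure L)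
        (fun U => ∫ h, (S₂ ∪ S₃)ᶜ.indicator v (gaugeTransform (basedExt L h) U) ∂basedMeasure L) ≤ a₁ * N)
    (h₂ : qform su2Rep β (fun U => ∫ h, S₂.indicator v (gaugeTransform (basedExt L h) U) ∂basedMeasure L)
        (fun U => ∫ h, S₂.indicator v (gaugeTransform (basedExt L h) U) ∂basedMeasure L) ≤ a₂ * N)
    (h₃ : qform su2Rep β (fun U => ∫ h, (S₃ \ S₂).indicator v (gaugeTransform (basedExt L h) U) ∂basedMeasure L)
        (fun U => ∫ h, (S₃ \ S₂).indicator v (gaugeTransform (basedExt L h) U) ∂basedMeasure L) ≤ a₃ * N) :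
    tubeForm β v ≤ (Real.sqrt a₁ + Real.sqrt a₂ + Real.sqrt a₃) ^ 2 * N := by
  obtain ⟨hKm, ⟨CM, hKb⟩, hKs, hKp⟩ := transferKernel_kform_data (L := L) hβ
  -- the pieces and their based averages
  obtain ⟨hv₁, hCv₁⟩ := indicator_piece_props hv hCv ((hS₂.union hS₃).compl)
  obtain ⟨hv₂, hCv₂⟩ := indicator_piece_props hv hCv hS₂
  obtain ⟨hv₃, hCv₃⟩ := indicator_piece_props hv hCv (hS₃.diff hS₂)
  obtain ⟨hP₁m, hP₁b⟩ := basedIntegral_props (L := L) hv₁ hCv₁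
  obtain ⟨hP₂m, hP₂b⟩ := basedIntegral_props (L := L) hv₂ hCv₂
  obtain ⟨hP₃m, hP₃b⟩ := basedIntegral_props (L := L) hv₃ hCv₃
  -- `P₀v = P₀v₁ + P₀v₂ + P₀v₃`
  have hsum : (fun U => ∫ h, v (gaugeTransform (basedExt L h) U) ∂basedMeasure L) = fun U =>
      (∫ h, (S₂ ∪ S₃)ᶜ.indicator v (gaugeTransform (basedExt L h) U) ∂basedMeasure L) + (∫ h, S₂.indicator v (gaugeTransform (basedExt L h) U) ∂basedMeasure L) +
        ∫ h, (S₃ \ S₂).indicator v (gaugeTransform (basedExt L h) U) ∂basedMeasure L := by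
    funext U
    have h12 : Measurable fun W => (S₂ ∪ S₃)ᶜ.indicator v W + S₂.indicator v W := hv₁.add hv₂
    have h12b : ∀ W, |(S₂ ∪ S₃)ᶜ.indicator v W + S₂.indicator v W| ≤ Cv + Cv := fun W => (abs_add_le _ _).trans (add_le_add (hCv₁ W) (hCv₂ W))
    rw [← basedIntegral_add hv₁ hCv₁ hv₂ hCv₂ U, ← basedIntegral_add h12 h12b hv₃ hCv₃ U]
    exact integral_congr_ae (ae_of_all _ fun h => three_piece_decomp v S₂ S₃ _)
  -- step (A) and the seminorm triangle
  have hA := tubeForm_le_qform_basedIntegral (L := L) hβ hv hCv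
  rw [hsum] at hA
  have hFm : Measurable fun U => (∫ h, (S₂ ∪ S₃)ᶜ.indicator v (gaugeTransform (basedExt L h) U) ∂basedMeasure L) +
      (∫ h, S₂.indicator v (gaugeTransform (basedExt L h) U) ∂basedMeasure L) + ∫ h, (S₃ \ S₂).indicator v (gaugeTransform (basedExt L h) U) ∂basedMeasure L :=
    (hP₁m.add hP₂m).add hP₃m
  have hFb : ∀ U, |(∫ h, (S₂ ∪ S₃)ᶜ.indicator v (gaugeTransform (basedExt L h) U) ∂basedMeasure L) +
      (∫ h, S₂.indicator v (gaugeTransform (basedExt L h) U) ∂basedMeasure L) + ∫ h, (S₃ \ S₂).indicator v (gaugeTransform (basedExt L h) U) ∂basedMeasure L| ≤ Cv + Cv + Cv :=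
    fun U => (abs_add_le _ _).trans (add_le_add ((abs_add_le _ _).trans (add_le_add (hP₁b U) (hP₂b U))) (hP₃b U))
  rw [qform_eq_integral_integral_bdd β hFm hFb] at hA
  rw [qform_eq_integral_integral_bdd β hP₁m hP₁b] at h₁
  rw [qform_eq_integral_integral_bdd β hP₂m hP₂b] at h₂
  rw [qform_eq_integral_integral_bdd β hP₃m hP₃b] at h₃
  have hs₁ : 0 ≤ Real.sqrt (a₁ * N) := Real.sqrt_nonneg _
  have hs₂ : 0 ≤ Real.sqrt (a₂ * N) := Real.sqrt_nonneg _
  have hs₃ : 0 ≤ Real.sqrt (a₃ * N) := Real.sqrt_nonneg _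
  have h₁' : ∫ U, ∫ V, (∫ h, (S₂ ∪ S₃)ᶜ.indicator v (gaugeTransform (basedExt L h) U) ∂basedMeasure L) * transferKernel su2Rep β U V *
      (∫ h, (S₂ ∪ S₃)ᶜ.indicator v (gaugeTransform (basedExt L h) V) ∂basedMeasure L) ∂configMeasure SU2 L ∂configMeasure SU2 L ≤ Real.sqrt (a₁ * N) ^ 2 := by
    rwa [Real.sq_sqrt (mul_nonneg ha₁ hN)]
  have h₂' : ∫ U, ∫ V, (∫ h, S₂.indicator v (gaugeTransform (basedExt L h) U) ∂basedMeasure L) * transferKernel su2Rep β U V *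
      (∫ h, S₂.indicator v (gaugeTransform (basedExt L h) V) ∂basedMeasure L) ∂configMeasure SU2 L ∂configMeasure SU2 L ≤ Real.sqrt (a₂ * N) ^ 2 := by
    rwa [Real.sq_sqrt (mul_nonneg ha₂ hN)]
  have h₃' : ∫ U, ∫ V, (∫ h, (S₃ \ S₂).indicator v (gaugeTransform (basedExt L h) U) ∂basedMeasure L) * transferKernel su2Rep β U V *
      (∫ h, (S₃ \ S₂).indicator v (gaugeTransform (basedExt L h) V) ∂basedMeasure L) ∂configMeasure SU2 L ∂configMeasure SU2 L ≤ Real.sqrt (a₃ * N) ^ 2 := by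
    rwa [Real.sq_sqrt (mul_nonneg ha₃ hN)]
  have htri := kform_add_three_le_of_le (μ := configMeasure SU2 L) hKm hKb hKs hKp hP₁m hP₁b hP₂m hP₂b hP₃m hP₃b hs₁ hs₂ hs₃ h₁' h₂' h₃'
  have hfac : (Real.sqrt (a₁ * N) + Real.sqrt (a₂ * N) + Real.sqrt (a₃ * N)) ^ 2 = (Real.sqrt a₁ + Real.sqrt a₂ + Real.sqrt a₃) ^ 2 * N := by
    rw [Real.sqrt_mul ha₁, Real.sqrt_mul ha₂, Real.sqrt_mul ha₃]
    have hN' : Real.sqrt N ^ 2 = N := Real.sq_sqrt hN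
    nlinarith [hN']
  linarith [hA, htri, hfac]

/-- The weighted norm `‖v‖²_w = ∫ v² w` is nonnegative for a nonnegative weight. [folklore] -/
theorem tubeNormSq_nonneg {w v : GaugeConfig 3 L SU2 → ℝ} (hw : ∀ U, 0 ≤ w U) : 0 ≤ tubeNormSq w v := by
  unfold tubeNormSq; exact integral_nonneg fun U => mul_nonneg (sq_nonneg _) (hw U)

/-- ★★★ **`hST` from three piece bounds** (the top-level assembly of the (B-ST) pen, abstract in the weight `χ`, the currency `Λ`, the orthogonality predicate `Adm` and the
two cut sets): if for every admissible `v` (bounded measurable, supported in `{χ ≠ 0}`, `Adm v`) the core piece `𝟙_{(S₂∪S₃)ᶜ} v`, the far piece `𝟙_{S₂} v` and the shell piece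
`𝟙_{S₃∖S₂} v` satisfy `⟨P₀vᵢ, K_β P₀vᵢ⟩ ≤ aᵢ·tubeNormSq (softWeight χ) v`, and `(√a₁ + √a₂ + √a₃)² ≤ (1 − θ₀)Λ`, then
`tubeForm β v ≤ (1 − θ₀)·Λ·tubeNormSq (softWeight χ) v` for every admissible `v` — literally the body of `hST`. [cite: SeilerLNP1982, §3] [cite: Luscher1983, §3] -/
theorem hST_of_pieces {β : ℝ} (hβ : 0 ≤ β) {χ : GaugeConfig 3 L SU2 → ℝ} (hw0 : ∀ U, 0 ≤ softWeight χ U) (Adm : (GaugeConfig 3 L SU2 → ℝ) → Prop)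
    {S₂ S₃ : Set (GaugeConfig 3 L SU2)} (hS₂ : MeasurableSet S₂) (hS₃ : MeasurableSet S₃) {Λ θ₀ a₁ a₂ a₃ : ℝ} (ha₁ : 0 ≤ a₁) (ha₂ : 0 ≤ a₂) (ha₃ : 0 ≤ a₃)
    (habc : (Real.sqrt a₁ + Real.sqrt a₂ + Real.sqrt a₃) ^ 2 ≤ (1 - θ₀) * Λ)
    (hcore : ∀ v : GaugeConfig 3 L SU2 → ℝ, Measurable v → (∃ C : ℝ, ∀ U, |v U| ≤ C) → (∀ U, v U ≠ 0 → χ U ≠ 0) → Adm v →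
      qform su2Rep β (fun U => ∫ h, (S₂ ∪ S₃)ᶜ.indicator v (gaugeTransform (basedExt L h) U) ∂basedMeasure L)
        (fun U => ∫ h, (S₂ ∪ S₃)ᶜ.indicator v (gaugeTransform (basedExt L h) U) ∂basedMeasure L) ≤ a₁ * tubeNormSq (softWeight χ) v)
    (hfar : ∀ v : GaugeConfig 3 L SU2 → ℝ, Measurable v → (∃ C : ℝ, ∀ U, |v U| ≤ C) → (∀ U, v U ≠ 0 → χ U ≠ 0) → Adm v →
      qform su2Rep β (fun U => ∫ h, S₂.indicator v (gaugeTransform (basedExt L h) U) ∂basedMeasure L)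
        (fun U => ∫ h, S₂.indicator v (gaugeTransform (basedExt L h) U) ∂basedMeasure L) ≤ a₂ * tubeNormSq (softWeight χ) v)
    (hshell : ∀ v : GaugeConfig 3 L SU2 → ℝ, Measurable v → (∃ C : ℝ, ∀ U, |v U| ≤ C) → (∀ U, v U ≠ 0 → χ U ≠ 0) → Adm v →
      qform su2Rep β (fun U => ∫ h, (S₃ \ S₂).indicator v (gaugeTransform (basedExt L h) U) ∂basedMeasure L)
        (fun U => ∫ h, (S₃ \ S₂).indicator v (gaugeTransform (basedExt L h) U) ∂basedMeasure L) ≤ a₃ * tubeNormSq (softWeight χ) v) :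
    ∀ v : GaugeConfig 3 L SU2 → ℝ, Measurable v → (∃ C : ℝ, ∀ U, |v U| ≤ C) → (∀ U, v U ≠ 0 → χ U ≠ 0) → Adm v →
      tubeForm β v ≤ (1 - θ₀) * Λ * tubeNormSq (softWeight χ) v := by
  intro v hv hC hsupp hadm
  obtain ⟨Cv, hCv⟩ := hC
  have hN : 0 ≤ tubeNormSq (softWeight χ) v := tubeNormSq_nonneg hw0
  have h := tubeForm_le_of_pieces hβ hv hCv hS₂ hS₃ ha₁ ha₂ ha₃ hN (hcore v hv ⟨Cv, hCv⟩ hsupp hadm) (hfar v hv ⟨Cv, hCv⟩ hsupp hadm) (hshell v hv ⟨Cv, hCv⟩ hsupp hadm)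
  exact h.trans (mul_le_mul_of_nonneg_right habc hN)

/-- The numerical closing condition in the form it is used: with `a₁ ≤ (1 − 4θ₀)Λ` (core) and tails `a₂, a₃ ≤ ε Λ`, `16 ε ≤ θ₀²`, `0 < θ₀ ≤ 1/4`, `0 ≤ Λ`:
`(√a₁ + √a₂ + √a₃)² ≤ (1 − θ₀)Λ`. [folklore] -/
theorem pieces_budget {Λ θ₀ ε a₁ a₂ a₃ : ℝ} (hΛ : 0 ≤ Λ) (hθ₀ : 0 < θ₀) (hθ₁ : θ₀ ≤ 1 / 4) (hε : 0 ≤ ε) (hεθ : 16 * ε ≤ θ₀ ^ 2)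
    (h₁ : a₁ ≤ (1 - 4 * θ₀) * Λ) (h₂ : a₂ ≤ ε * Λ) (h₃ : a₃ ≤ ε * Λ) :
    (Real.sqrt a₁ + Real.sqrt a₂ + Real.sqrt a₃) ^ 2 ≤ (1 - θ₀) * Λ := by
  have hsΛ : 0 ≤ Real.sqrt Λ := Real.sqrt_nonneg _
  have hΛ' : Real.sqrt Λ ^ 2 = Λ := Real.sq_sqrt hΛ
  have h12 : 0 ≤ 1 - 4 * θ₀ := by linarith
  -- `√a₁ ≤ √(1−4θ₀) √Λ`, `√a₂, √a₃ ≤ √ε √Λ`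
  have hb₁ : Real.sqrt a₁ ≤ Real.sqrt (1 - 4 * θ₀) * Real.sqrt Λ := by rw [← Real.sqrt_mul h12]; exact Real.sqrt_le_sqrt h₁
  have hb₂ : Real.sqrt a₂ ≤ Real.sqrt ε * Real.sqrt Λ := by rw [← Real.sqrt_mul hε]; exact Real.sqrt_le_sqrt h₂
  have hb₃ : Real.sqrt a₃ ≤ Real.sqrt ε * Real.sqrt Λ := by rw [← Real.sqrt_mul hε]; exact Real.sqrt_le_sqrt h₃
  -- `√ε ≤ θ₀/4`, `√(1−4θ₀) ≤ 1 − 2θ₀`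
  have hsε : Real.sqrt ε ≤ θ₀ / 4 := by
    rw [← Real.sqrt_sq (by linarith : (0 : ℝ) ≤ θ₀ / 4)]; exact Real.sqrt_le_sqrt (by nlinarith)
  have hs12 : Real.sqrt (1 - 4 * θ₀) ≤ 1 - 2 * θ₀ := by
    rw [← Real.sqrt_sq (by linarith : (0 : ℝ) ≤ 1 - 2 * θ₀)]; exact Real.sqrt_le_sqrt (by nlinarith)
  have hsum : Real.sqrt a₁ + Real.sqrt a₂ + Real.sqrt a₃ ≤ (1 - 3 * θ₀ / 2) * Real.sqrt Λ := by
    have e1 : Real.sqrt (1 - 4 * θ₀) * Real.sqrt Λ ≤ (1 - 2 * θ₀) * Real.sqrt Λ := mul_le_mul_of_nonneg_right hs12 hsΛ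
    have e2 : Real.sqrt ε * Real.sqrt Λ ≤ θ₀ / 4 * Real.sqrt Λ := mul_le_mul_of_nonneg_right hsε hsΛ
    linarith
  have h0 : 0 ≤ Real.sqrt a₁ + Real.sqrt a₂ + Real.sqrt a₃ := by positivity
  have hsq := pow_le_pow_left₀ h0 hsum 2
  refine hsq.trans ?_
  rw [mul_pow, hΛ']
  have : (1 - 3 * θ₀ / 2) ^ 2 ≤ 1 - θ₀ := by nlinarith
  exact mul_le_mul_of_nonneg_right this hΛ

end Summit.QuantumFields.YangMills.Theorems.FemtoTransferGap.TwoLattice.ConstTube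

end
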